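import Literature.AlgebraicGeometry.Resolution.KawasakiBlowupPieces
import Literature.AlgebraicGeometry.Resolution.MacaulayficationKawasakiInput
import Literature.RingTheory.Nullstellensatz.MaximalIdealsPolynomialFibre
import HarnessLib

/-!
# Kawasaki's theorem on Cohen–Macaulay blow-ups: the induction on the charts

Topic: `Literature/AlgebraicGeometry/Resolution`. This file proves the heart of Kawasaki 2000,
Thm. 4.1 = Česnavičius 2021, Thm. 3.13 in chart form: for a finite module `M` over a Noetherian
local ring `(R, 𝔪)`, an (abstract) `p`-standard system of parameters `xs = x_1,…,x_d` of `M`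
(`IsPStandard M xs`; in Česnavičius's numbering `r_t = x_{d+1-t}`), a subsystem of parameters
`ys ⊆ 𝔪` of `M/(x_{p+1},…,x_d)M` and the blow-up of `M̄ = M/(ys)M` along the product ideal

`I_p = ∏_{t=p}^{d-1} (x_{t+1}, …, x_d) = ∏_{i ≤ s} (r_1, …, r_i)`, `s = d - p`,

the chart modules `M̄_{(g)} = R[I_p/g] · M̄ ⊆ M̄[1/g]` on the RECURSIVE charts `g` (products of one
generator from each factor, each new factor being either the new parameter or the previous one,
`AdmChart`) satisfy

`Hʲ_𝔔(M̄_{(g)}) = 0` for `j < s = d - p` at every maximal ideal `𝔔 ⊇ 𝔪` of `R[I_p/g]`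

(`AdmChart.cechVanishBelow`, Čech local cohomology in vanishing form): "the depth of
`Bl_{I_s}(M)` at each closed point of its support is at least `s`" (Česnavičius 2021, proof of
Thm. 3.13, (Mpr-to-Mprpr)), by induction on `s` for all `M̄` simultaneously. The base `s = 1` is
the `r_1`-regularity of `M̄_{(r_1)}`; the step is `cechVanishBelow_chartModule_mul`
(`BlowupChartTransition.lean`: Stacks 080A + the local cohomology computation of
`KawasakiChartStep.lean`), fed by Kawasaki's (KI-b), (KI-c) (`MacaulayficationKawasakiInput.lean`)
through `KawasakiBlowupPieces.lean` and `TwoElementSaturation.lean`.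

Everything is proved; no named facts.

## References

* [Kawasaki2000] T. Kawasaki, *On Macaulayfication of Noetherian schemes*, Trans. AMS 352 (2000),
  Thm. 4.1, Lemma 4.3 and its proof (pp. 2532–2536).
* [Cesnavicius2021] K. Česnavičius, *Macaulayfication of Noetherian schemes*, Duke Math. J. 170
  (2021), Thm. 3.13 and its proof.
* [StacksProject] The Stacks Project, Tags 080A, 0804.
-/

noncomputable section

open IsLocalization Pointwise Ideal IsLocalRing Polynomial
  Literature.RingTheory.LocalCohomology Literature.RingTheory.Nullstellensatz

namespace Literature.AlgebraicGeometry.Resolution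

universe u

variable {R : Type u} [CommRing R]

/-! ## The centre `I_p` and the recursive charts -/

/-- **The centre at level `p`**: `I_p = ∏_{t=p}^{d-1} (x_{t+1},…,x_d)` (Česnavičius's
`I_s = ∏_{i ≤ s} (r_1,…,r_i)`, `s = d - p`). [cite: Cesnavicius2021, Thm. 3.13]
[cite: Kawasaki2000, Thm. 4.1] -/
abbrev kCentre (xs : List R) (p : ℕ) : Ideal R := prodPow xs (fun _ => 1) p (xs.length - 1)

/-- `I_p = (x_{p+1},…,x_d) · I_{p+1}` for `p + 1 < d`. [folklore] -/
theorem kCentre_eq_mul {xs : List R} {p : ℕ} (hp : p + 1 < xs.length) :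
    kCentre xs p = kCentre xs (p + 1) * tailIdeal xs p := by
  rw [kCentre, prodPow_eq_mul _ (by omega : p ≤ xs.length - 1), pow_one, mul_comm]

/-- `I_{d-1} = (x_d)`. [folklore] -/
theorem kCentre_length_sub_one (xs : List R) :
    kCentre xs (xs.length - 1) = tailIdeal xs (xs.length - 1) := by
  rw [kCentre, prodPow_self, pow_one]

/-- `I_{p+1} ⊆ (x_{p+1},…,x_d)`. [folklore] -/
theorem kCentre_succ_le_tailIdeal {xs : List R} {p : ℕ} (hp : p + 1 < xs.length) :
    kCentre xs (p + 1) ≤ tailIdeal xs p :=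
  (prodPow_le_tailIdeal (k := p + 1) (Finset.mem_Icc.mpr ⟨le_rfl, by omega⟩) one_pos).trans
    (tailIdeal_antitone xs (Nat.le_succ p))

/-- **The recursive charts of `Bl_{I_p}`**: `AdmChart xs p g c` records a chart denominator `g` of
the centre `I_p` (a product of one generator from each factor) whose last factor is `c`, built
recursively: at level `d - 1` the only chart is `g = c = x_d`; from a chart `(g, c)` at level
`p + 1` one passes to level `p` with the new factor either the new parameter `x_{p+1}`
(`g x_{p+1}`) or the old one `c` (`g c`) — the two charts of `Bl_{(c, x_{p+1})}(Spec R[I_{p+1}/g])`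
(Stacks 080A; Česnavičius: "`(r_1,…,r_s)R' = (r_a, r_b)R'` … the explicit affine cover of
`Bl_{(r_a,r_b)}(R')`"). [cite: Cesnavicius2021, proof of Thm. 3.13] -/
inductive AdmChart (xs : List R) : ℕ → R → R → Prop
  | base (h : 0 < xs.length) :
      AdmChart xs (xs.length - 1) (xs[xs.length - 1]) (xs[xs.length - 1])
  | new {p : ℕ} {g c : R} (h : AdmChart xs (p + 1) g c) (hp : p < xs.length) :
      AdmChart xs p (g * xs[p]) (xs[p])
  | old {p : ℕ} {g c : R} (h : AdmChart xs (p + 1) g c) (hp : p < xs.length) :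
      AdmChart xs p (g * c) c

namespace AdmChart

variable {xs : List R} {p : ℕ} {g c : R}

/-- Charts only exist at levels `p < d`. [folklore] -/
theorem lt (h : AdmChart xs p g c) : p < xs.length := by
  cases h with
  | base h => omega
  | new _ hp => exact hp
  | old _ hp => exact hp

/-- The last factor lies in `(x_{p+1},…,x_d)`. [folklore] -/
theorem mem_tailIdeal (h : AdmChart xs p g c) : c ∈ tailIdeal xs p := by
  induction h with
  | base h => exact getElem_mem_tailIdeal le_rfl _
  | new _ hp _ => exact getElem_mem_tailIdeal le_rfl hp
  | old _ _ ih => exact tailIdeal_antitone xs (Nat.le_succ _) ih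

/-- The denominator lies in the centre. [folklore] -/
theorem mem_kCentre (h : AdmChart xs p g c) : g ∈ kCentre xs p := by
  induction h with
  | base h => rw [kCentre_length_sub_one]; exact getElem_mem_tailIdeal le_rfl _
  | new h' hp ih =>
    rw [kCentre_eq_mul h'.lt]
    exact Ideal.mul_mem_mul ih (getElem_mem_tailIdeal le_rfl hp)
  | old h' _ ih =>
    rw [kCentre_eq_mul h'.lt]
    exact Ideal.mul_mem_mul ih (tailIdeal_antitone xs (Nat.le_succ _) h'.mem_tailIdeal)

/-- The last factor divides the denominator. [folklore] -/
theorem dvd (h : AdmChart xs p g c) : c ∣ g := by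
  cases h with
  | base h => exact dvd_rfl
  | new _ hp => exact dvd_mul_left _ _
  | old _ hp => exact dvd_mul_left _ _

/-- **`(x_{p+1},…,x_d) R[I_p/g] = c R[I_p/g]`**: on a recursive chart the last factor of the centre
becomes principal, generated by the last factor of the denominator (Stacks 07Z3 (2), iterated).
[cite: Cesnavicius2021, proof of Thm. 3.13 ("`r_i` generates the ideal `(r_1,…,r_{s-1})R'`")] -/
theorem exists_eq_mul_algebraMap (h : AdmChart xs p g c) {z : R} (hz : z ∈ tailIdeal xs p) :
    ∃ u : blowupAlgebra (kCentre xs p) g,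
      algebraMap R (blowupAlgebra (kCentre xs p) g) z =
        u * algebraMap R (blowupAlgebra (kCentre xs p) g) c := by
  -- in all cases `g = g₀ c'` with `z g₀ ∈ I_p`; then `u = z g₀ / g`
  have key : ∀ g₀ : R, g = g₀ * c → z * g₀ ∈ kCentre xs p →
      ∃ u : blowupAlgebra (kCentre xs p) g,
        algebraMap R (blowupAlgebra (kCentre xs p) g) z =
          u * algebraMap R (blowupAlgebra (kCentre xs p) g) c := by
    intro g₀ hg hzg
    refine ⟨blowupAlgebra.divPow (kCentre xs p) g (n := 1) (y := z * g₀) (by rwa [pow_one]), ?_⟩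
    apply Subtype.ext
    rw [Subalgebra.coe_algebraMap, Subalgebra.coe_mul, Subalgebra.coe_algebraMap,
      blowupAlgebra.coe_divPow, pow_one, map_mul, mul_assoc, mul_assoc,
      mul_comm (Away.invSelf g), ← mul_assoc (algebraMap R _ g₀), ← map_mul, ← hg,
      Away.mul_invSelf, mul_one]
  cases h with
  | base h =>
    refine key 1 (by rw [one_mul]) ?_
    rw [mul_one, kCentre_length_sub_one]
    exact hz
  | @new p g₀ c₀ h' hp =>
    refine key g₀ rfl ?_
    rw [kCentre_eq_mul h'.lt, mul_comm]
    exact Ideal.mul_mem_mul hz h'.mem_kCentre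
  | @old p g₀ c₀ h' hp =>
    refine key g₀ rfl ?_
    rw [kCentre_eq_mul h'.lt, mul_comm]
    exact Ideal.mul_mem_mul hz h'.mem_kCentre

/-- **`(x_{p+1},…,x_d) R[I_{p+1}/g] = (x_{p+1}, c) R[I_{p+1}/g]`** for a chart `(g, c)` at level
`p + 1`: the hypothesis `hJ` of `rho_surjective`/`cechVanishBelow_chartModule_mul`, for either
orientation of the pair. [cite: Cesnavicius2021, proof of Thm. 3.13] -/
theorem exists_pair (h : AdmChart xs (p + 1) g c) (hp : p < xs.length) {a b : R}
    (hor : (b = xs[p] ∧ a = c) ∨ (b = c ∧ a = xs[p])) :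
    ∀ z ∈ tailIdeal xs p, ∃ α β : blowupAlgebra (kCentre xs (p + 1)) g,
      algebraMap R (blowupAlgebra (kCentre xs (p + 1)) g) z =
        α * algebraMap R (blowupAlgebra (kCentre xs (p + 1)) g) a +
          β * algebraMap R (blowupAlgebra (kCentre xs (p + 1)) g) b := by
  intro z hz
  rw [tailIdeal_eq_span_sup hp, Submodule.mem_sup] at hz
  obtain ⟨z₁, hz₁, z₂, hz₂, rfl⟩ := hz
  obtain ⟨l, rfl⟩ := Ideal.mem_span_singleton'.mp hz₁
  obtain ⟨u, hu⟩ := h.exists_eq_mul_algebraMap hz₂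
  rcases hor with ⟨rfl, rfl⟩ | ⟨rfl, rfl⟩
  · exact ⟨u, algebraMap R _ l, by rw [map_add, map_mul, hu]; ring⟩
  · exact ⟨algebraMap R _ l, u, by rw [map_add, map_mul, hu]⟩

end AdmChart

/-! ## Inputs from (KI-b), (KI-c) on `M̄ = M/(ys)M` -/

section Inputs

variable [IsLocalRing R] [IsNoetherianRing R]
variable {M : Type u} [AddCommGroup M] [Module R M] [Module.Finite R M]
variable {xs : List R}

/-- **(KI-c) on `M̄`**: for `z ∈ (x_{p+1},…,x_d)`, `k, n ≥ 1` and `m̄ ∈ M̄ = M/(ys)M`,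
`x_{p+1}ᵏ m̄ ∈ I_{p+1}ⁿ M̄` implies `z m̄ ∈ I_{p+1}ⁿ M̄`. [cite: Cesnavicius2021, Prop. 3.10 (c)]
[cite: Kawasaki2000, Cor. 3.2] -/
theorem colon_kCentre_pow (hx : IsPStandard M xs) {p : ℕ} (hp : p + 1 < xs.length)
    {ys : List R} (hys : IsSecantSequence M (xs.drop p ++ ys))
    (hym : ∀ y ∈ ys, y ∈ maximalIdeal R) {z : R} (hz : z ∈ tailIdeal xs p) {k : ℕ} (hk : 1 ≤ k)
    (n : ℕ) (hn : 1 ≤ n) (m' : M ⧸ (ofList ys • ⊤ : Submodule R M))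
    (hm' : (xs[p]'(by omega)) ^ k • m' ∈ kCentre xs (p + 1) ^ n •
      (⊤ : Submodule R (M ⧸ (ofList ys • ⊤ : Submodule R M)))) :
    z • m' ∈ kCentre xs (p + 1) ^ n • (⊤ : Submodule R (M ⧸ (ofList ys • ⊤ : Submodule R M))) := by
  induction m' using Submodule.Quotient.induction_on with | _ m =>
  have hc := hx.kawasakiInput_c hp (m := k) (n := n) (by omega) (by omega) hys hym
  rw [prodPow_const] at hc
  have hpow : kCentre xs (p + 1) ^ n = prodPow xs (fun _ => 1) (p + 1) (xs.length - 1) ^ n := rfl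
  rw [← Submodule.Quotient.mk_smul, ← Submodule.mkQ_apply, mkQ_mem_smul_top_iff] at hm' ⊢
  have hm : m ∈ colonBy (ofList ys • ⊤ ⊔ prodPow xs (fun _ => 1) (p + 1) (xs.length - 1) ^ n • ⊤ :
      Submodule R M) (xs[p] ^ k) := hm'
  rw [hc, mem_colonByIdeal] at hm
  exact hm z hz

/-- **(KI-b) + Goto–Yamagishi on `M̄`**: `x_{p+1}` is injective on `I_{p+1}ⁿ M̄` for `n ≥ 1`
(`x_{p+1}, …` is a `d`-sequence on `M̄`, so `(0 :_{M̄} x_{p+1}) ∩ (x_{p+1},…,x_d)M̄ = 0`).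
[cite: Cesnavicius2021, proof of Thm. 3.13, proof of Claim 3.13.2] [cite: Kawasaki2000, Thm. 2.2] -/
theorem smul_eq_zero_kCentre_pow (hx : IsPStandard M xs) {p : ℕ} (hp : p + 1 < xs.length)
    {ys : List R} (hys : IsSecantSequence M (xs.drop p ++ ys))
    (hym : ∀ y ∈ ys, y ∈ maximalIdeal R) (n : ℕ) (hn : 1 ≤ n)
    (m' : M ⧸ (ofList ys • ⊤ : Submodule R M))
    (hm' : m' ∈ kCentre xs (p + 1) ^ n • (⊤ : Submodule R (M ⧸ (ofList ys • ⊤ : Submodule R M))))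
    (h0 : (xs[p]'(by omega)) • m' = 0) : m' = 0 := by
  induction m' using Submodule.Quotient.induction_on with | _ m =>
  have hKD := hx.kawasakiInput_b p hys hym
  have h0' : 0 < (xs.drop p).length := by rw [List.length_drop]; omega
  obtain ⟨n, rfl⟩ : ∃ n', n = n' + 1 := ⟨n - 1, by omega⟩
  have hGY := hKD.colonBy_inf_sup_pow_smul_top n h0'
  simp only [List.take_zero, ofList_nil, Submodule.bot_smul, sup_bot_eq, List.getElem_drop,
    Nat.add_zero] at hGY
  rw [← Submodule.mkQ_apply, mkQ_mem_smul_top_iff] at hm'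
  rw [Submodule.Quotient.mk_eq_zero]
  have h1 : m ∈ colonBy (ofList ys • ⊤ : Submodule R M) xs[p] := by
    rw [mem_colonBy, ← Submodule.Quotient.mk_eq_zero, Submodule.Quotient.mk_smul]
    exact h0
  have hle : kCentre xs (p + 1) ^ (n + 1) • (⊤ : Submodule R M) ≤
      ofList (xs.drop p) ^ (n + 1) • (⊤ : Submodule R M) :=
    Submodule.smul_mono_left (Ideal.pow_right_mono (kCentre_succ_le_tailIdeal hp) (n + 1))
  have h2 : m ∈ (ofList ys • ⊤ : Submodule R M) ⊔ ofList (xs.drop p) ^ (n + 1) • ⊤ :=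
    (sup_le_sup_left hle _) hm'
  have : m ∈ colonBy (ofList ys • ⊤ : Submodule R M) xs[p] ⊓
      ((ofList ys • ⊤ : Submodule R M) ⊔ ofList (xs.drop p) ^ (n + 1) • ⊤) := ⟨h1, h2⟩
  rwa [hGY] at this

/-- **Secant bookkeeping for the pieces**: `ys, x_{p+1}ᵏ` is a subsystem of parameters of
`M/(x_{p+2},…,x_d)M` (`k ≥ 1`). [cite: Cesnavicius2021, §3.2, Rem. 3.11] -/
theorem isSecantSequence_drop_succ_append_pow (hx : IsPStandard M xs) {p : ℕ} (hp : p < xs.length)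
    {ys : List R} (hys : IsSecantSequence M (xs.drop p ++ ys))
    (hym : ∀ y ∈ ys, y ∈ maximalIdeal R) {k : ℕ} (hk : 0 < k) :
    IsSecantSequence M (xs.drop (p + 1) ++ (ys ++ [xs[p] ^ k])) := by
  have hmem : ∀ r ∈ xs.drop p ++ ys, r ∈ maximalIdeal R := fun r hr => by
    rcases List.mem_append.mp hr with h | h
    · exact hx.mem_maximalIdeal r (List.mem_of_mem_drop h)
    · exact hym r h
  have hperm : (xs.drop p ++ ys).Perm ((xs.drop (p + 1) ++ ys) ++ [xs[p]]) := by
    rw [List.drop_eq_getElem_cons hp, List.cons_append]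
    exact List.perm_append_comm (l₁ := [xs[p]]) (l₂ := xs.drop (p + 1) ++ ys)
  have h1 := hys.of_perm hperm hmem
  have h2 := h1.append_pow hk
  rwa [List.append_assoc] at h2

/-- `ys` is a subsystem of parameters of `M/(x_{p+2},…,x_d)M` if it is one of `M/(x_{p+1},…)M`.
[cite: Cesnavicius2021, §3.2] -/
theorem isSecantSequence_drop_succ (hx : IsPStandard M xs) {p : ℕ}
    {ys : List R} (hys : IsSecantSequence M (xs.drop p ++ ys))
    (hym : ∀ y ∈ ys, y ∈ maximalIdeal R) :
    IsSecantSequence M (xs.drop (p + 1) ++ ys) := by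
  refine hys.sublist ((List.drop_sublist_drop_left xs (Nat.le_succ p)).append_right ys)
    fun r hr => ?_
  · rcases List.mem_append.mp hr with h | h
    · exact hx.mem_maximalIdeal r (List.mem_of_mem_drop h)
    · exact hym r h

/-- **`M̄/x M̄ ≅ M/(ys, x)M`.** [folklore] -/
def quotQuotEquiv (ys : List R) (x : R) :
    ((M ⧸ (ofList ys • ⊤ : Submodule R M)) ⧸
      x • (⊤ : Submodule R (M ⧸ (ofList ys • ⊤ : Submodule R M)))) ≃ₗ[R]
      M ⧸ (ofList (ys ++ [x]) • ⊤ : Submodule R M) :=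
  Submodule.quotEquivOfEq _ _ (by
    rw [Submodule.map_pointwise_smul, Submodule.map_top, Submodule.range_mkQ]) ≪≫ₗ
  Submodule.quotientQuotientEquivQuotientSup (ofList ys • ⊤ : Submodule R M) (x • ⊤) ≪≫ₗ
  Submodule.quotEquivOfEq _ _ (by
    rw [ofList_append, ofList_singleton, Submodule.sup_smul, Submodule.ideal_span_singleton_smul])

end Inputs

/-! ## The induction -/

section Induction

variable [IsLocalRing R] [IsNoetherianRing R]
variable {M : Type u} [AddCommGroup M] [Module R M] [Module.Finite R M]
variable {xs : List R}

omit [IsNoetherianRing R] in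
/-- `r ∈ 𝔪` maps into every ideal containing `𝔪 A`. [folklore] -/
theorem algebraMap_mem_of_map_le {A : Type*} [CommRing A] [Algebra R A] {𝔔 : Ideal A}
    (h𝔔 : (maximalIdeal R).map (algebraMap R A) ≤ 𝔔) {r : R} (hr : r ∈ maximalIdeal R) :
    algebraMap R A r ∈ 𝔔 :=
  h𝔔 (Ideal.mem_map_of_mem _ hr)

omit [IsNoetherianRing R] in
/-- **The base of the induction** (`s = 1`): `H⁰_𝔔(M̄_{(x_d)}) = 0`, since `x_d ∈ 𝔔` is
`M̄_{(x_d)}`-regular. [cite: Cesnavicius2021, proof of Thm. 3.13 ("the case `s = 1` follows from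
(3.12.1), which implies that `r_1` is not a zero divisor on `Bl_{I_1}(M)`")] -/
theorem cechVanishBelow_base {I : Ideal R} {g : R} (hgm : g ∈ maximalIdeal R)
    (E : Type u) [AddCommGroup E] [Module R E]
    {𝔔 : Ideal (blowupAlgebra I g)} (h𝔔 : (maximalIdeal R).map (algebraMap R _) ≤ 𝔔)
    {t : ℕ} {y : Fin t → blowupAlgebra I g} (hy : Ideal.span (Set.range y) = 𝔔) :
    CechVanishBelow y (chartModule I g E) 1 := by
  have hreg : IsSMulRegular (chartModule I g E) (algebraMap R (blowupAlgebra I g) g) :=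
    (isSMulRegular_algebraMap_iff I g g).mpr
      (chartModule.isSMulRegular_of_dvd I g E (n := 1) (by rw [pow_one]))
  exact CechVanishBelow.of_quotSMulTop hreg
    (Ideal.le_radical (hy ▸ algebraMap_mem_of_map_le h𝔔 hgm)) CechVanishBelow.zero

set_option maxHeartbeats 1600000 in
-- one long assembly of the inductive step; many instances on localized chart modules
/-- **The inductive step** (Česnavičius 2021, proof of Thm. 3.13, from (Mpr-to-Mprpr) to the end):
from the statement at level `p + 1` (for ALL `M̄ = M/(ys)M` and all maximal `𝔔 ⊇ 𝔪` of the
recursive chart ring `R[I_{p+1}/g]`) to level `p` on both charts `g x_{p+1}` and `g c` of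
`Bl_{(c, x_{p+1})}(Spec R[I_{p+1}/g])`. The orientation `(b, a) = (x_{p+1}, c)` or `(c, x_{p+1})`
names the new denominator `b`. [cite: Cesnavicius2021, Thm. 3.13, proof]
[cite: Kawasaki2000, Thm. 4.1, Lemma 4.3] -/
theorem cechVanishBelow_step (hx : IsPStandard M xs) {p : ℕ} {g c : R}
    (hch : AdmChart xs (p + 1) g c) (hp : p < xs.length)
    (IH : ∀ {ys : List R}, IsSecantSequence M (xs.drop (p + 1) ++ ys) →
      (∀ y ∈ ys, y ∈ maximalIdeal R) →
      ∀ (𝔔 : Ideal (blowupAlgebra (kCentre xs (p + 1)) g)), 𝔔.IsMaximal →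
        (maximalIdeal R).map (algebraMap R _) ≤ 𝔔 →
        ∀ {t : ℕ} {y : Fin t → blowupAlgebra (kCentre xs (p + 1)) g},
          Ideal.span (Set.range y) = 𝔔 →
          CechVanishBelow y (chartModule (kCentre xs (p + 1)) g
            (M ⧸ (ofList ys • ⊤ : Submodule R M))) (xs.length - (p + 1)))
    {ys : List R} (hys : IsSecantSequence M (xs.drop p ++ ys)) (hym : ∀ y ∈ ys, y ∈ maximalIdeal R)
    {b a : R} (hor : (b = xs[p] ∧ a = c) ∨ (b = c ∧ a = xs[p]))
    (𝔔' : Ideal (blowupAlgebra (kCentre xs (p + 1) * tailIdeal xs p) (g * b))) (h𝔔' : 𝔔'.IsMaximal)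
    (h𝔔'm : (maximalIdeal R).map (algebraMap R _) ≤ 𝔔')
    {t' : ℕ} {y' : Fin t' → blowupAlgebra (kCentre xs (p + 1) * tailIdeal xs p) (g * b)}
    (hy' : Ideal.span (Set.range y') = 𝔔') :
    CechVanishBelow y' (chartModule (kCentre xs (p + 1) * tailIdeal xs p) (g * b)
      (M ⧸ (ofList ys • ⊤ : Submodule R M))) (xs.length - p) := by
  -- basic memberships
  have hp1 : p + 1 < xs.length := hch.lt
  have hg : g ∈ (kCentre xs (p + 1)) := hch.mem_kCentre
  have hcg : c ∣ g := hch.dvd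
  have hxJ : xs[p] ∈ (tailIdeal xs p) := getElem_mem_tailIdeal le_rfl hp
  have hcJ : c ∈ (tailIdeal xs p) := tailIdeal_antitone xs (Nat.le_succ p) hch.mem_tailIdeal
  have hxm : xs[p] ∈ maximalIdeal R := hx.mem_maximalIdeal _ (List.getElem_mem hp)
  have hJm : (tailIdeal xs p) ≤ maximalIdeal R := Ideal.span_le.mpr fun r hr =>
    hx.mem_maximalIdeal r (List.mem_of_mem_drop hr)
  have hcm : c ∈ maximalIdeal R := hJm hcJ
  have hb : b ∈ (tailIdeal xs p) := by rcases hor with ⟨rfl, -⟩ | ⟨rfl, -⟩ <;> assumption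
  have ha : a ∈ (tailIdeal xs p) := by rcases hor with ⟨-, rfl⟩ | ⟨-, rfl⟩ <;> assumption
  have hbm : b ∈ maximalIdeal R := hJm hb
  have ham : a ∈ maximalIdeal R := hJm ha
  have hJ := hch.exists_pair hp hor
  -- regularity of `c` and `x_{p+1}` on `N = M̄_{(g)}`
  have hcN : IsSMulRegular (chartModule (kCentre xs (p + 1)) g (M ⧸ (ofList ys • ⊤ : Submodule R M))) (algebraMap R (blowupAlgebra (kCentre xs (p + 1)) g) c) :=
    (isSMulRegular_algebraMap_iff (kCentre xs (p + 1)) g c).mpr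
      (chartModule.isSMulRegular_of_dvd (kCentre xs (p + 1)) g (M ⧸ (ofList ys • ⊤ : Submodule R M)) (n := 1) (by rwa [pow_one]))
  have hxN : IsSMulRegular (chartModule (kCentre xs (p + 1)) g (M ⧸ (ofList ys • ⊤ : Submodule R M))) (algebraMap R (blowupAlgebra (kCentre xs (p + 1)) g) xs[p]) :=
    (isSMulRegular_algebraMap_iff (kCentre xs (p + 1)) g _).mpr
      (chartModule.isSMulRegular_of_forall_pow (kCentre xs (p + 1)) g hg fun n hn m' hm' h0 =>
        smul_eq_zero_kCentre_pow hx hp1 hys hym n hn m' hm' h0)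
  have hbN : IsSMulRegular (chartModule (kCentre xs (p + 1)) g (M ⧸ (ofList ys • ⊤ : Submodule R M))) (algebraMap R (blowupAlgebra (kCentre xs (p + 1)) g) b) := by
    rcases hor with ⟨rfl, -⟩ | ⟨rfl, -⟩
    · exact hxN
    · exact hcN
  -- the maximal ideals `𝔑 = ρ⁻¹ 𝔔'` of `A[T]` and `𝔓 = 𝔑 ∩ (blowupAlgebra (kCentre xs (p + 1)) g)`
  set ρ := rho (kCentre xs (p + 1)) (tailIdeal xs p) g b a hg hb ha with hρdef
  have hρ : Function.Surjective ρ := rho_surjective (kCentre xs (p + 1)) (tailIdeal xs p) g b a hg hb ha hJ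
  set 𝔑 : Ideal (blowupAlgebra (kCentre xs (p + 1)) g)[X] := 𝔔'.comap ρ with h𝔑def
  haveI h𝔑 : 𝔑.IsMaximal := Ideal.comap_isMaximal_of_surjective ρ hρ
  have hρC : ∀ r : R, ρ (algebraMap R (blowupAlgebra (kCentre xs (p + 1)) g)[X] r) = algebraMap R _ r := fun r => by
    apply Subtype.ext
    rw [Polynomial.algebraMap_apply, coe_rho, chi_C, Subalgebra.coe_algebraMap, awayMul_algebraMap,
      Subalgebra.coe_algebraMap]
  have h𝔑m : (maximalIdeal R).map (algebraMap R (blowupAlgebra (kCentre xs (p + 1)) g)[X]) ≤ 𝔑 := by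
    rw [Ideal.map_le_iff_le_comap]
    intro r hr
    rw [Ideal.mem_comap, h𝔑def, Ideal.mem_comap, hρC]
    exact algebraMap_mem_of_map_le h𝔔'm hr
  haveI : Algebra.FiniteType R (blowupAlgebra (kCentre xs (p + 1)) g) := finiteType_blowupAlgebra (kCentre xs (p + 1)) g (IsNoetherian.noetherian (kCentre xs (p + 1)))
  haveI : IsNoetherianRing (blowupAlgebra (kCentre xs (p + 1)) g) := isNoetherianRing_blowupAlgebra_of_isNoetherianRing (kCentre xs (p + 1)) g
  have h𝔓 : (𝔑.comap (C : (blowupAlgebra (kCentre xs (p + 1)) g) →+* (blowupAlgebra (kCentre xs (p + 1)) g)[X])).IsMaximal := isMaximal_comap_C_of_map_le 𝔑 h𝔑m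
  set 𝔓 : Ideal (blowupAlgebra (kCentre xs (p + 1)) g) := 𝔑.comap (C : (blowupAlgebra (kCentre xs (p + 1)) g) →+* (blowupAlgebra (kCentre xs (p + 1)) g)[X]) with h𝔓def
  have h𝔓m : (maximalIdeal R).map (algebraMap R (blowupAlgebra (kCentre xs (p + 1)) g)) ≤ 𝔓 := by
    rw [Ideal.map_le_iff_le_comap]
    intro r hr
    rw [Ideal.mem_comap, h𝔓def, Ideal.mem_comap, ← Polynomial.algebraMap_apply]
    exact h𝔑m (Ideal.mem_map_of_mem _ hr)
  obtain ⟨t, y, hy⟩ := Submodule.fg_iff_exists_fin_generating_family.mp (IsNoetherian.noetherian 𝔓)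
  have hyI : Ideal.span (Set.range y) = 𝔓 := hy
  obtain ⟨f, hf, hfy⟩ := exists_monic_and_span_cons_eq 𝔑 h𝔓 hyI
  have ha' : algebraMap R (blowupAlgebra (kCentre xs (p + 1)) g) a ∈ (Ideal.span (Set.range y)).radical :=
    Ideal.le_radical (by rw [hyI]; exact algebraMap_mem_of_map_le h𝔓m ham)
  have hb' : algebraMap R (blowupAlgebra (kCentre xs (p + 1)) g) b ∈ (Ideal.span (Set.range y)).radical :=
    Ideal.le_radical (by rw [hyI]; exact algebraMap_mem_of_map_le h𝔓m hbm)
  have hc' : algebraMap R (blowupAlgebra (kCentre xs (p + 1)) g) c ∈ (Ideal.span (Set.range y)).radical :=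
    Ideal.le_radical (by rw [hyI]; exact algebraMap_mem_of_map_le h𝔓m hcm)
  have hx' : algebraMap R (blowupAlgebra (kCentre xs (p + 1)) g) xs[p] ∈ (Ideal.span (Set.range y)).radical :=
    Ideal.le_radical (by rw [hyI]; exact algebraMap_mem_of_map_le h𝔓m hxm)
  -- the induction hypothesis at `𝔓` for `N`
  have hsm1 : xs.length - (p + 1) = (xs.length - (p + 1) - 1) + 1 := by omega
  have hN : CechVanishBelow y (chartModule (kCentre xs (p + 1)) g (M ⧸ (ofList ys • ⊤ : Submodule R M))) (xs.length - (p + 1) - 1 + 1) :=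
    hsm1 ▸ IH (isSecantSequence_drop_succ hx hys hym) hym 𝔓 h𝔓 h𝔓m hy
  -- the pair `(c, x_{p+1})`: `ι₀ : N → N[1/(c x_{p+1})]`, `ιx : N → N[1/x_{p+1}]`
  set cA := algebraMap R (blowupAlgebra (kCentre xs (p + 1)) g) c with hcA
  set xA := algebraMap R (blowupAlgebra (kCentre xs (p + 1)) g) xs[p] with hxA
  -- (`N[1/(c x_{p+1})]` is realised as `Nb _ _ (c x_{p+1}) _`, whose instances are registered)
  let ι₀ := ιb (kCentre xs (p + 1)) g (c * xs[p]) (M ⧸ (ofList ys • ⊤ : Submodule R M))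
  haveI hι₀ : IsLocalizedModule (Submonoid.powers (cA * xA)) ι₀ :=
    (map_mul (algebraMap R (blowupAlgebra (kCentre xs (p + 1)) g)) c xs[p]) ▸
      (inferInstance : IsLocalizedModule
        (Submonoid.powers (bA (kCentre xs (p + 1)) g (c * xs[p]))) ι₀)
  let ιx := ιb (kCentre xs (p + 1)) g xs[p] (M ⧸ (ofList ys • ⊤ : Submodule R M))
  -- the pieces `N/K_k ≅ (M/(ys, x_{p+1}ᵏ))_{(g)}` and the vanishing of `Hʲ(range φ)`
  have hcolon : ∀ {z : R}, z ∈ (tailIdeal xs p) → ∀ k, 1 ≤ k → ∀ n, 1 ≤ n → ∀ m' : (M ⧸ (ofList ys • ⊤ : Submodule R M)),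
      xs[p] ^ k • m' ∈ (kCentre xs (p + 1)) ^ n • (⊤ : Submodule R (M ⧸ (ofList ys • ⊤ : Submodule R M))) → z • m' ∈ (kCentre xs (p + 1)) ^ n • (⊤ : Submodule R (M ⧸ (ofList ys • ⊤ : Submodule R M))) :=
    fun hz k hk n hn m' hm' => colon_kCentre_pow hx hp1 hys hym hz hk n hn m' hm'
  have hpieces : ∀ k, CechVanishBelow y (chartModule (kCentre xs (p + 1)) g (M ⧸ (ofList ys • ⊤ : Submodule R M)) ⧸
      LinearMap.ker (phi ι₀ ιx cA xA ∘ₗ psi ιx xA k)) (xs.length - (p + 1)) := by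
    intro k
    rcases Nat.eq_zero_or_pos k with rfl | hk
    · -- every `n` lies in the kernel for `k = 0` (`c⁰ n = x⁰ n`), so the quotient vanishes
      have hker : LinearMap.ker (phi ι₀ ιx cA xA ∘ₗ psi ιx xA 0) = ⊤ := by
        rw [eq_top_iff]
        rintro n -
        rw [mem_ker_phi_comp_psi_iff ι₀ ιx cA xA hcN hxN 0 n]
        exact ⟨0, n, by rw [pow_zero, pow_zero]⟩
      haveI := Submodule.Quotient.subsingleton_iff.mpr hker
      exact CechVanishBelow.of_subsingleton _
    · rw [chartModule.ker_phi_comp_psi_eq (kCentre xs (p + 1)) g c xs[p] hg (nc := 1) (by rwa [pow_one]) ι₀ ιx hcN hxN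
        (fun n hn m' hm' => hcolon hcJ k hk n hn m' hm')]
      refine CechVanishBelow.of_equiv
        ((chartModule.quotKerPowEquiv (kCentre xs (p + 1)) g xs[p] k).trans
          (chartModuleCongr (kCentre xs (p + 1)) g (quotQuotEquiv ys (xs[p] ^ k)))).symm ?_
      exact IH (isSecantSequence_drop_succ_append_pow hx hp hys hym hk)
        (fun r hr => by
          rcases List.mem_append.mp hr with h | h
          · exact hym r h
          · rw [List.mem_singleton.mp h]; exact Ideal.pow_mem_of_mem _ hxm k hk)
        𝔓 h𝔓 h𝔓m hy
  have hD : CechVanishBelow y (LinearMap.range (phi ι₀ ιx cA xA)) (xs.length - (p + 1) - 1 + 1) :=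
    hsm1 ▸ cechVanishBelow_range_phi_of_pieces ι₀ ιx cA xA hpieces
  obtain ⟨hE1, hE2⟩ := cechVanishBelow_E1_E2 ι₀ ιx cA xA hc' hx' hcN hxN hN hD
  -- Claim 3.13.2
  have hkill : ∀ ω ∈ sat ι₀ cA ⊓ sat ι₀ xA, cA • ω ∈ LinearMap.range ι₀ ∧ xA • ω ∈ LinearMap.range ι₀ := by
    refine chartModule.hkill (kCentre xs (p + 1)) g c xs[p] ι₀ hxN fun k hk n hn => ?_
    have hmem : n ∈ LinearMap.ker (chartModuleMap (kCentre xs (p + 1)) g ((xs[p] ^ k • (⊤ : Submodule R (M ⧸ (ofList ys • ⊤ : Submodule R M)))).mkQ)) :=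
      (chartModule.mem_ker_chartModuleMap_pow_iff (kCentre xs (p + 1)) g c xs[p] hg (nc := 1) (by rwa [pow_one])
        (fun n hn m' hm' => hcolon hcJ k hk n hn m' hm') n).mpr hn
    constructor
    · have h := chartModule.smul_mem_of_mem_ker (kCentre xs (p + 1)) g hg
        (fun n hn m' hm' => hcolon hcJ k hk n hn m' hm') hmem
      rw [Submodule.mem_smul_pointwise_iff_exists] at h
      obtain ⟨n₄, -, h⟩ := h
      exact ⟨n₄, by rw [algebraMap_smul, algebraMap_pow_smul_chartModule, h]⟩
    · have h := chartModule.smul_mem_of_mem_ker (kCentre xs (p + 1)) g hg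
        (fun n hn m' hm' => hcolon hxJ k hk n hn m' hm') hmem
      rw [Submodule.mem_smul_pointwise_iff_exists] at h
      obtain ⟨n₄, -, h⟩ := h
      exact ⟨n₄, by rw [algebraMap_smul, algebraMap_pow_smul_chartModule, h]⟩
  -- generators of `𝔔'` from those of `𝔑`
  have hgen : Ideal.span (Set.range y') =
      (Ideal.span (Set.range (Fin.cons f (yB (blowupAlgebra (kCentre xs (p + 1)) g)[X] y) : Fin (t + 1) → (blowupAlgebra (kCentre xs (p + 1)) g)[X]))).map ρ := by
    have hyB : (yB (blowupAlgebra (kCentre xs (p + 1)) g)[X] y) = fun i => C (y i) := rfl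
    rw [hyB, hfy, h𝔑def, Ideal.map_comap_of_surjective ρ hρ, hy']
  have hfin : xs.length - p = xs.length - (p + 1) - 1 + 2 := by omega
  rw [hfin]
  -- the two orientations
  rcases hor with ⟨hb0, ha0⟩ | ⟨hb0, ha0⟩
  · -- new denominator `x_{p+1}`, `a = c`
    subst hb0; subst a
    exact cechVanishBelow_chartModule_mul (kCentre xs (p + 1)) (tailIdeal xs p) g xs[p] c (M ⧸ (ofList ys • ⊤ : Submodule R M)) hg hb ha hJ hbN ha' hb'
      (smul_bijective_quotient_sat ι₀ cA xA) (phi ι₀ ιx cA xA)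
      (fun v hv => smul_eq_zero_of_mem_ker_phi ι₀ ιx cA xA hcN hkill hv)
      (hE1.of_equiv (kerPhiEquiv ι₀ ιx cA xA hcN).symm)
      (hE2.of_equiv (cokerPhiEquiv ι₀ ιx cA xA).symm) hf hgen
  · -- new denominator `c`, `a = x_{p+1}`: swap the roles using the symmetric models
    subst b; subst ha0
    haveI : IsLocalizedModule (Submonoid.powers (xA * cA)) ι₀ :=
      (mul_comm cA xA) ▸ (inferInstance : IsLocalizedModule (Submonoid.powers (cA * xA)) ι₀)
    let ιc := ιb (kCentre xs (p + 1)) g c (M ⧸ (ofList ys • ⊤ : Submodule R M))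
    have hkill' : ∀ ω ∈ sat ι₀ xA ⊓ sat ι₀ cA,
        xA • ω ∈ LinearMap.range ι₀ ∧ cA • ω ∈ LinearMap.range ι₀ := fun ω hω =>
      (hkill ω ⟨hω.2, hω.1⟩).symm
    exact cechVanishBelow_chartModule_mul (kCentre xs (p + 1)) (tailIdeal xs p) g c xs[p] (M ⧸ (ofList ys • ⊤ : Submodule R M)) hg hb ha hJ hbN ha' hb'
      (smul_bijective_quotient_sat ι₀ xA cA) (phi ι₀ ιc xA cA)
      (fun v hv => smul_eq_zero_of_mem_ker_phi ι₀ ιc xA cA hxN hkill' hv)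
      ((hE1.of_equiv (E1Comm ι₀ cA xA)).of_equiv (kerPhiEquiv ι₀ ιc xA cA hxN).symm)
      ((hE2.of_equiv (E2Comm ι₀ cA xA)).of_equiv (cokerPhiEquiv ι₀ ιc xA cA).symm) hf hgen

/-- **Kawasaki 2000, Thm. 4.1 / Česnavičius 2021, Thm. 3.13 on the recursive charts**: for a
`p`-standard system of parameters `xs` of `M`, a subsystem of parameters `ys ⊆ 𝔪` of
`M/(x_{p+1},…,x_d)M`, a recursive chart `(g, c)` of the blow-up along
`I_p = ∏_{t ≥ p} (x_{t+1},…,x_d)` and a maximal ideal `𝔔 ⊇ 𝔪` of `R[I_p/g]` generated by `y`,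
the chart module `(M/(ys)M)_{(g)}` has `Hʲ_{(y)} = 0` for `j < d - p`: "the depth of
`Bl_{I_s}(M)` at each closed point of its support is at least `s`".
[cite: Kawasaki2000, Thm. 4.1 (4.1.1)] [cite: Cesnavicius2021, Thm. 3.13, proof ((Mpr-to-Mprpr))] -/
theorem AdmChart.cechVanishBelow (hx : IsPStandard M xs) {p : ℕ} {g c : R}
    (hch : AdmChart xs p g c) :
    ∀ {ys : List R}, IsSecantSequence M (xs.drop p ++ ys) → (∀ y ∈ ys, y ∈ maximalIdeal R) →
      ∀ (𝔔 : Ideal (blowupAlgebra (kCentre xs p) g)), 𝔔.IsMaximal →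
        (maximalIdeal R).map (algebraMap R _) ≤ 𝔔 →
        ∀ {t : ℕ} {y : Fin t → blowupAlgebra (kCentre xs p) g}, Ideal.span (Set.range y) = 𝔔 →
          CechVanishBelow y (chartModule (kCentre xs p) g (M ⧸ (ofList ys • ⊤ : Submodule R M)))
            (xs.length - p) := by
  induction hch with
  | base h =>
    intro ys _ _ 𝔔 _ h𝔔 t y hy
    rw [show xs.length - (xs.length - 1) = 1 by omega]
    exact cechVanishBelow_base (hx.mem_maximalIdeal _ (List.getElem_mem _)) _ h𝔔 hy
  | new hch hp ih =>
    rw [kCentre_eq_mul hch.lt]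
    intro ys hys hym 𝔔 h𝔔 h𝔔m t y hy
    exact cechVanishBelow_step hx hch hp ih hys hym (Or.inl ⟨rfl, rfl⟩) 𝔔 h𝔔 h𝔔m hy
  | old hch hp ih =>
    rw [kCentre_eq_mul hch.lt]
    intro ys hys hym 𝔔 h𝔔 h𝔔m t y hy
    exact cechVanishBelow_step hx hch hp ih hys hym (Or.inr ⟨rfl, rfl⟩) 𝔔 h𝔔 h𝔔m hy

end Induction

end Literature.AlgebraicGeometry.Resolution

end
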